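import Summits.Parity.BatemanHorn.Theorems.SoloInformedPowerValuesRpow
import Summits.Parity.BatemanHorn.Theorems.SoloInformedQuadraticPrimeCount

/-!
# Smooth values of a polynomial are `O(log^{P+1} x)`

SOLOIST deliverable (unit `solo-Parity-informed`, session 16).  For `g ∈ ℤ[X]` of degree `d ≥ 1` and a
fixed bound `P`, the `n ≤ x` at which `|g(n)| ≠ 0` has all its prime factors `≤ P` are very few: such a value
is `∏_{q ≤ P} q^{e_q} ≤ e^B x^d` with every `e_q ≤ log₂(e^B x^d)`, so there are `≤ (log₂(e^B x^d) + 1)^{P+1}`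
values, each taken `≤ 2d` times:

* `card_filter_smooth_le` : `#{1 ≤ m ≤ Y : m is P-smooth} ≤ (log₂ Y + 1)^{P+1}`;
* `card_filter_smooth_eval_le` : `#{1 ≤ n ≤ x : |g(n)| ≠ 0 P-smooth} ≤ (log₂ Y + 1)^{P+1} · 2d` when
  `|g(n)| ≤ Y` on `[1, x]`;
* `eventually_card_smoothValues_mul_log_pow_le` : hence `# · log^j x ≤ δ x` eventually, every `j`, `δ > 0`.

In a Bateman–Horn system the primes dividing two of the values `fᵢ(n)`, `fⱼ(n)` (`i ≠ j`) are bounded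
(`Literature.NumberTheory.Sieve.exists_forall_not_dvd_eval_and_dvd_eval`), and an argument `n` at which
`Λ_k(|∏ fᵢ(n)|) ≠ 0` although not all `|fᵢ(n)|` are prime has some `|fᵢ(n)|` a proper prime power or some
`|fᵢ(n)|` smooth in this sense; this file bounds the second kind.
-/

namespace Summit.Parity.BatemanHorn.Theorems

open Finset Filter Polynomial Asymptotics
open scoped Topology

/-- **`P`-smooth numbers up to `Y` are `≤ (log₂ Y + 1)^{P+1}`** (injectivity of the exponent vector). -/
theorem card_filter_smooth_le (P Y : ℕ) :
    #((Icc 1 Y).filter fun m : ℕ => ∀ q ∈ m.primeFactors, q ≤ P) ≤ (Nat.log 2 Y + 1) ^ (P + 1) := by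
  classical
  set K := Nat.log 2 Y with hK
  set S := (Icc 1 Y).filter fun m : ℕ => ∀ q ∈ m.primeFactors, q ≤ P with hS
  let φ : ℕ → (Fin (P + 1) → ℕ) := fun m i => m.factorization i
  have hmem : ∀ m ∈ S, m ≠ 0 ∧ m ≤ Y ∧ ∀ q ∈ m.primeFactors, q ≤ P := by
    intro m hm
    obtain ⟨hmI, hsm⟩ := mem_filter.mp hm
    obtain ⟨hm1, hmY⟩ := mem_Icc.mp hmI
    exact ⟨by omega, hmY, hsm⟩
  calc #S ≤ #(Fintype.piFinset fun _ : Fin (P + 1) => range (K + 1)) := by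
        refine card_le_card_of_injOn φ ?_ ?_
        · intro m hm
          rw [mem_coe] at hm
          obtain ⟨hm0, hmY, -⟩ := hmem m hm
          rw [mem_coe, Fintype.mem_piFinset]
          intro i
          rw [mem_range, Nat.lt_add_one_iff]
          by_cases hi : (i : ℕ).Prime
          · have h1 : (i : ℕ) ^ m.factorization i ≤ m := Nat.ordProj_le _ hm0
            have h2 : 2 ^ m.factorization i ≤ (i : ℕ) ^ m.factorization i :=
              Nat.pow_le_pow_left hi.two_le _
            exact Nat.le_log_of_pow_le (by norm_num) ((h2.trans h1).trans hmY)
          · simp [φ, Nat.factorization_eq_zero_of_not_prime m hi]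
        · intro m₁ hm₁ m₂ hm₂ h
          rw [mem_coe] at hm₁ hm₂
          obtain ⟨h10, -, hs1⟩ := hmem m₁ hm₁
          obtain ⟨h20, -, hs2⟩ := hmem m₂ hm₂
          have hzero : ∀ {m : ℕ}, (∀ q ∈ m.primeFactors, q ≤ P) → ∀ q, ¬ q ≤ P → m.factorization q = 0 := by
            intro m hs q hq
            rw [Nat.factorization_eq_zero_iff]
            by_contra hcon
            push Not at hcon
            obtain ⟨hqp, hqd, hm0⟩ := hcon
            exact hq (hs q (Nat.mem_primeFactors.mpr ⟨hqp, hqd, hm0⟩))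
          refine Nat.factorization_inj (Set.mem_setOf.mpr h10) (Set.mem_setOf.mpr h20) ?_
          ext q
          by_cases hq : q ≤ P
          · have := congr_fun h ⟨q, Nat.lt_add_one_iff.mpr hq⟩
            simpa [φ] using this
          · rw [hzero hs1 q hq, hzero hs2 q hq]
    _ = (K + 1) ^ (P + 1) := by
        rw [Fintype.card_piFinset, prod_const, card_range, card_univ, Fintype.card_fin]

/-- **`P`-smooth values of a polynomial:** if `|g(n)| ≤ Y` for `1 ≤ n ≤ x` then
`#{1 ≤ n ≤ x : |g(n)| ≠ 0, all prime factors ≤ P} ≤ (log₂ Y + 1)^{P+1} · 2 deg g`. -/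
theorem card_filter_smooth_eval_le (g : ℤ[X]) (hdeg : 0 < g.natDegree) (x P Y : ℕ)
    (hY : ∀ n ∈ Icc 1 x, (g.eval (n : ℤ)).natAbs ≤ Y) :
    #((Icc 1 x).filter fun n : ℕ => (g.eval (n : ℤ)).natAbs ≠ 0 ∧
        ∀ q ∈ ((g.eval (n : ℤ)).natAbs).primeFactors, q ≤ P)
      ≤ (Nat.log 2 Y + 1) ^ (P + 1) * (2 * g.natDegree) := by
  classical
  set S := (Icc 1 Y).filter fun m : ℕ => ∀ q ∈ m.primeFactors, q ≤ P with hS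
  have hsub : ((Icc 1 x).filter fun n : ℕ => (g.eval (n : ℤ)).natAbs ≠ 0 ∧
      ∀ q ∈ ((g.eval (n : ℤ)).natAbs).primeFactors, q ≤ P)
      ⊆ S.biUnion fun m : ℕ => (Icc 1 x).filter fun n : ℕ => (g.eval (n : ℤ)).natAbs = m := by
    intro n hn
    obtain ⟨hnI, h0, hsm⟩ := mem_filter.mp hn
    refine mem_biUnion.mpr ⟨(g.eval (n : ℤ)).natAbs, ?_, mem_filter.mpr ⟨hnI, rfl⟩⟩
    exact mem_filter.mpr ⟨mem_Icc.mpr ⟨Nat.one_le_iff_ne_zero.mpr h0, hY n hnI⟩, hsm⟩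
  calc #((Icc 1 x).filter fun n : ℕ => (g.eval (n : ℤ)).natAbs ≠ 0 ∧
        ∀ q ∈ ((g.eval (n : ℤ)).natAbs).primeFactors, q ≤ P)
      ≤ ∑ m ∈ S, #((Icc 1 x).filter fun n : ℕ => (g.eval (n : ℤ)).natAbs = m) :=
        (card_le_card hsub).trans card_biUnion_le
    _ ≤ ∑ m ∈ S, 2 * g.natDegree := sum_le_sum fun m _ => card_filter_natAbs_eval_eq_le g hdeg _ m
    _ = #S * (2 * g.natDegree) := by rw [sum_const, smul_eq_mul]
    _ ≤ (Nat.log 2 Y + 1) ^ (P + 1) * (2 * g.natDegree) :=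
        Nat.mul_le_mul_right _ (card_filter_smooth_le P Y)

/-- **Smooth polynomial values are negligible against every power of `log`.**  For `g ∈ ℤ[X]` of degree
`≥ 1`, a bound `P`, every `j` and `δ > 0`:
`#{1 ≤ n ≤ x : |g(n)| ≠ 0 with all prime factors ≤ P} · log^j x ≤ δ x` eventually. -/
theorem eventually_card_smoothValues_mul_log_pow_le {g : ℤ[X]} (hdeg : 0 < g.natDegree) (P j : ℕ)
    {δ : ℝ} (hδ : 0 < δ) :
    ∀ᶠ x : ℕ in atTop,
      (#((Icc 1 x).filter fun n : ℕ => (g.eval (n : ℤ)).natAbs ≠ 0 ∧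
          ∀ q ∈ ((g.eval (n : ℤ)).natAbs).primeFactors, q ≤ P) : ℝ) * Real.log x ^ j ≤ δ * x := by
  classical
  obtain ⟨B, hB⟩ := exists_abs_log_natAbs_eval_sub_le hdeg
  have hB0 : 0 ≤ B := (abs_nonneg _).trans (hB 1 le_rfl)
  set d := g.natDegree with hd
  have hd0R : (0 : ℝ) < d := by exact_mod_cast hdeg
  have hlog2 : 0 < Real.log 2 := Real.log_pos (by norm_num)
  -- the constant: `K_x + 1 ≤ c₂ log x` once `log x ≥ 1`
  set c₂ : ℝ := (B + d) / Real.log 2 + 1 with hc₂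
  have hc₂0 : 0 < c₂ := by positivity
  set A : ℝ := c₂ ^ (P + 1) * (2 * d) with hA
  have hA0 : 0 < A := by positivity
  have hlog : Tendsto (fun x : ℕ => Real.log x) atTop atTop :=
    Real.tendsto_log_atTop.comp tendsto_natCast_atTop_atTop
  filter_upwards [eventually_log_pow_le_mul_rpow (P + 1 + j) one_pos (show 0 < δ / A by positivity),
    hlog.eventually (eventually_ge_atTop 1), eventually_ge_atTop 1] with x hx hL1 hx1
  rw [Real.rpow_one] at hx
  have hx0 : (0 : ℝ) < x := by exact_mod_cast hx1
  have hL0 : 0 ≤ Real.log x := by linarith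
  -- the size bound `|g(n)| ≤ Y = ⌊e^B x^d⌋` on `[1, x]`
  set Y : ℕ := ⌊Real.exp B * (x : ℝ) ^ d⌋₊ with hYdef
  have hYle : ∀ n ∈ Icc 1 x, (g.eval (n : ℤ)).natAbs ≤ Y := by
    intro n hn
    obtain ⟨hn1, hnx⟩ := mem_Icc.mp hn
    refine Nat.le_floor ?_
    have h1 := (abs_le.mp (hB n hn1)).2
    have h2 : Real.log n ≤ Real.log x :=
      Real.log_le_log (by exact_mod_cast hn1) (by exact_mod_cast hnx)
    have h3 := mul_le_mul_of_nonneg_left h2 hd0R.le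
    rcases Nat.eq_zero_or_pos (g.eval (n : ℤ)).natAbs with h0 | hpos
    · rw [h0, Nat.cast_zero]; positivity
    have hg0 : (0 : ℝ) < ((g.eval (n : ℤ)).natAbs : ℕ) := by exact_mod_cast hpos
    rw [← Real.exp_log hg0, show Real.exp B * (x : ℝ) ^ d = Real.exp (Real.log ((x : ℝ) ^ d) + B) by
      rw [Real.exp_add, Real.exp_log (by positivity), mul_comm]]
    refine Real.exp_le_exp.mpr ?_
    rw [Real.log_pow]
    linarith
  -- `K_x = log₂ Y ≤ (B + d log x)/log 2`, so `K_x + 1 ≤ c₂ log x`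
  have hK : ((Nat.log 2 Y : ℕ) : ℝ) + 1 ≤ c₂ * Real.log x := by
    have hK1 : ((Nat.log 2 Y : ℕ) : ℝ) ≤ (B + d * Real.log x) / Real.log 2 := by
      rcases Nat.eq_zero_or_pos Y with hY0 | hYpos
      · rw [hY0, Nat.log_zero_right, Nat.cast_zero]
        positivity
      rw [le_div_iff₀ hlog2]
      have h1 : ((2 ^ Nat.log 2 Y : ℕ) : ℝ) ≤ Y := by exact_mod_cast Nat.pow_log_le_self 2 hYpos.ne'
      have h2 : (Y : ℝ) ≤ Real.exp B * (x : ℝ) ^ d := Nat.floor_le (by positivity)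
      have h3 : Real.log ((2 ^ Nat.log 2 Y : ℕ) : ℝ) ≤ Real.log (Real.exp B * (x : ℝ) ^ d) :=
        Real.log_le_log (by positivity) (h1.trans h2)
      rw [Nat.cast_pow, Nat.cast_ofNat, Real.log_pow,
        Real.log_mul (Real.exp_pos _).ne' (by positivity), Real.log_exp, Real.log_pow] at h3
      linarith
    have h4 : (B + d * Real.log x) / Real.log 2 + 1 ≤ c₂ * Real.log x := by
      rw [hc₂, add_mul, one_mul, div_mul_eq_mul_div, div_add_one hlog2.ne', div_add' _ _ _ hlog2.ne',
        div_le_div_iff_of_pos_right hlog2]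
      have hlog2' : Real.log 2 ≤ Real.log 2 * Real.log x := le_mul_of_one_le_right hlog2.le hL1
      nlinarith
    linarith
  have hcount := card_filter_smooth_eval_le g hdeg x P Y hYle
  rw [← hd] at hcount
  have hcountR : (#((Icc 1 x).filter fun n : ℕ => (g.eval (n : ℤ)).natAbs ≠ 0 ∧
      ∀ q ∈ ((g.eval (n : ℤ)).natAbs).primeFactors, q ≤ P) : ℝ)
      ≤ ((((Nat.log 2 Y : ℕ) : ℝ) + 1) ^ (P + 1)) * (2 * d) := by exact_mod_cast hcount
  calc (#((Icc 1 x).filter fun n : ℕ => (g.eval (n : ℤ)).natAbs ≠ 0 ∧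
        ∀ q ∈ ((g.eval (n : ℤ)).natAbs).primeFactors, q ≤ P) : ℝ) * Real.log x ^ j
      ≤ ((((Nat.log 2 Y : ℕ) : ℝ) + 1) ^ (P + 1)) * (2 * d) * Real.log x ^ j :=
        mul_le_mul_of_nonneg_right hcountR (pow_nonneg hL0 j)
    _ ≤ (c₂ * Real.log x) ^ (P + 1) * (2 * d) * Real.log x ^ j := by gcongr
    _ = A * Real.log x ^ (P + 1 + j) := by rw [hA, mul_pow, pow_add]; ring
    _ ≤ A * (δ / A * x) := mul_le_mul_of_nonneg_left hx hA0.le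
    _ = δ * x := by field_simp

end Summit.Parity.BatemanHorn.Theorems
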